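import Literature.AlgebraicGeometry.AbelianSchemes.TorsionSectionTranslationAction
import Literature.AlgebraicGeometry.AbelianSchemes.AbelianSchemeIsLambdaOfAtBaseChange
import Literature.AlgebraicGeometry.AbelianSchemes.AbelianSchemeConstSubgroupStableCoverOfHom
import HarnessLib

/-!
# The `M`-torsion sections of `A_T` at a geometric point `t` of `T`: points of `A_{t ≫ f}`, the translation action over
# `[M]`, and the Poincaré slice — the W1c square of the W3 transport ([MumfordAV1970] §20; [GortzWedhorn2020] (4.7))

Layer `Literature/AlgebraicGeometry/AbelianSchemes`, namespace `Literature.AlgebraicGeometry.AbelianSchemes.AbelianSchemeOver`.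
DEFINITIONS WITH BODIES AND THEOREMS ONLY (no named fact, no instance, no notation, no `sorry`).  Sequel of ★
`TorsionSectionTranslationAction` (W3-core FILE 1).

Setting: an abelian scheme `A/S`, a base change `f : T ⟶ S`, the `M`-torsion sections `A_T[M](T)` of `A_T = A ×_S T`
(★ `torsionSections`) acting on `A_T` by translations over `[M]_{A_T}` (★ `translationActionMulN`), and a geometric point
`t : Spec Ω ⟶ T` of `T`.  The cell's (h9-S) transport (W3) compares the pairing units over `T` (★ W1b `TorsionSectionPairing`
read for `A` over `S` with THIS `f`, so that only `S` needs to be reduced) with the Weil pairing on the fibre `A_{t ≫ f}`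
(★ W3a `FibreWeilPairingDiscrepancy` at `s := t ≫ f`), along the square `A_{t ≫ f} → A_T` over `t` (★ `baseChangeRestrict`).
This file supplies the point-side data of that square, once:

* §1 `sectionToPointHom f : A_T(T) →* A(T/S)` (a section of `A_T → T` as a `T`-point of `A` over `S`), and the `T`-point
  `torsionPointHat M f D lam k : T → Â` of an `M`-torsion section (`= λ ∘ pr_A ∘ k`) with **`torsionPointHat_pow_eq_one`**
  (`c^M = 1`) — the `(c, hc)` of ★ `TorsionPairing.exists_poincarePairingUnit_fun`;
* §2 `sectionAt f t : A_T(T) →* A_{t ≫ f}(Spec Ω)` (restriction to `t` through ★ `baseChangeCompGrpIso⁻¹ : (A_T)_t ≅ A_{t ≫ f}`),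
  **`baseChangeTorsionPt M f t : A_T[M](T) →* A_{t ≫ f}[M](Ω)`** with `coe_baseChangeTorsionPt` (`= fibrePointsMulEquiv f t (k(t))`,
  ★ `AbelianSchemeIsLambdaOfAtBaseChange`), the point action **`pointTranslationAction M f t : ActionOver ([M]_{A_{t ≫ f}}) (A_T[M](T))`**
  with **`pointTranslationAction_autHom_eq_translation`** (`ρ′_k = t_{k(t)}` — the `hg` of ★ W3a) and
  **`pointTranslationAction_autHom_comp_baseChangeRestrict`** (`ρ′_k ≫ q = q ≫ ρ_k` — the `hι` of ★ W1c; via ★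
  `translation_comp_hom` along `baseChangeCompGrpIso` and ★ `translation_sectionBaseChange`);
* §3 the Poincaré slices: **`baseChangeRestrict_comp_baseChangeToProd`** (`q ≫ (1 × c_k) = 1 × λ̄(k(t))`) and
  **`pointLineBundleIso`** — `𝒫|_{A_{t ≫ f} × {λ̄(k(t))}} ≅ q^*((1 × c_k)^*𝒫)`, the `j₁` of ★ W1c `discrepancy_baseChange`
  (Mathlib `Scheme.Modules.pullbackComp` / `pullbackCongr`).

Cell hodgecm-mathlib (D-0151), F-DAG (h9) symplectic half, (W3-core) FILE 2a (lead B-p11 (g16) 05:28:44Z; consumer FILE 2b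
`TorsionSectionGramUnits` and B-p13 (g19)'s FILE 3 `SymplecticLiftableOfOnePoint`). Count-neutral capital; HC_CM is proved only
modulo the 7 printed citations until rung 0 closes — nothing here is about HC.

## References
* [MumfordAV1970] D. Mumford, *Abelian Varieties* (1970), §7 Thm. 4 (p. 72), §20 (pp. 183–185).
* [GortzWedhorn2020] U. Görtz, T. Wedhorn, *Algebraic Geometry I*, 2nd ed. (2020), Section (4.7), (4.7.1) (p. 108) (base change,
  transitivity `(A ×_S T) ×_T T′ ≅ A ×_S T′`).
* [GortzWedhorn2023] U. Görtz, T. Wedhorn, *Algebraic Geometry II* (2023), Def./Rem. 27.1 (p. 604) (translations).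
* [MumfordFogartyKirwan1994] D. Mumford, J. Fogarty, F. Kirwan, *GIT*, 3rd ed., Ch. 7 §2 Def. 7.1 (p. 129) (sections on fibres);
  Ch. 6 §2 Def. 6.2–6.3 (p. 120) (`Λ(L)`, the slices `𝒫|_{A × {x̂}}`).
* [MilneAV2008] J. S. Milne, *Abelian Varieties* (2008), I §8 pp. 36–37 (`(1 × g)^*𝒫`).
-/

set_option autoImplicit false

noncomputable section

-- `Over`-morphism components and the transported group structures are compared across `def`s (as in the tree's W1 files).
set_option backward.isDefEq.respectTransparency false

universe u

open CategoryTheory CategoryTheory.Limits AlgebraicGeometry MonoidalCategory CartesianMonoidalCategory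
open scoped MonObj

namespace Literature.AlgebraicGeometry.AbelianSchemes.AbelianSchemeOver

open Literature.AlgebraicGeometry.RelativeSpec Literature.AlgebraicGeometry.Motives
  Literature.AlgebraicGeometry.AbelianVarieties

variable {S : Scheme.{u}} (A : AbelianSchemeOver S) (M : ℕ)

/-! ## §1 Sections of `A_T` as `T`-points of `A`; the `T`-points `c_k` of `Â` -/

section OverBase

open scoped CategoryTheory.Obj

variable {T : Scheme.{u}} (f : T ⟶ S) [IsCommMonObj (A.baseChange f).X]

/-- **A section of `A_T → T` as a `T`-valued point of `A` over `S`** (`k ↦ pr_A ∘ k`; the adjunction `Over.map f ⊣ Over.pullback f`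
at `𝟙_T`, precomposed with `Over.mk f ≅ Over.mk (𝟙 ≫ f)`), a group homomorphism. [cite: GortzWedhorn2020, Section (4.7), (4.7.1) (p. 108)] -/
def sectionToPointHom : (A.baseChange f).Sections →* (Over.mk f ⟶ A.X) where
  toFun k := (Over.homMk (𝟙 T) : Over.mk f ⟶ (Over.map f).obj (Over.mk (𝟙 T))) ≫
    ((Over.mapPullbackAdj f).homEquiv (Over.mk (𝟙 T)) A.X).symm k
  map_one' := by
    have h1 : ((Over.mapPullbackAdj f).homEquiv (Over.mk (𝟙 T)) A.X).symm (1 : (A.baseChange f).Sections) = 1 := by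
      rw [Equiv.symm_apply_eq]
      change _ = (Over.mapPullbackAdj f).homEquiv (Over.mk (𝟙 T)) A.X (1 : (Over.map f).obj (Over.mk (𝟙 T)) ⟶ A.X)
      erw [Adjunction.homEquiv_unit, Functor.map_one (Over.pullback f), MonObj.comp_one]
    rw [h1, MonObj.comp_one]
  map_mul' k k' := by
    have hm : ∀ x y : (Over.map f).obj (Over.mk (𝟙 T)) ⟶ A.X,
        (Over.mapPullbackAdj f).homEquiv (Over.mk (𝟙 T)) A.X (x * y) =
          (Over.mapPullbackAdj f).homEquiv (Over.mk (𝟙 T)) A.X x * (Over.mapPullbackAdj f).homEquiv (Over.mk (𝟙 T)) A.X y := by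
      intro x y
      erw [Adjunction.homEquiv_unit, Adjunction.homEquiv_unit, Adjunction.homEquiv_unit,
        Functor.map_mul (Over.pullback f) x y, MonObj.comp_mul]
    have h2 : ((Over.mapPullbackAdj f).homEquiv (Over.mk (𝟙 T)) A.X).symm (k * k') =
        ((Over.mapPullbackAdj f).homEquiv (Over.mk (𝟙 T)) A.X).symm k *
          ((Over.mapPullbackAdj f).homEquiv (Over.mk (𝟙 T)) A.X).symm k' := by
      rw [Equiv.symm_apply_eq, hm, Equiv.apply_symm_apply, Equiv.apply_symm_apply]
    rw [h2, MonObj.comp_mul]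

/-- `sectionToPointHom_left` (plumbing for the W3 transport square). [cite: GortzWedhorn2020, Section (4.7), (4.7.1) (p. 108)] -/
theorem sectionToPointHom_left (k : (A.baseChange f).Sections) :
    (A.sectionToPointHom f k).left = k.left ≫ pullback.fst A.X.hom f := by
  change 𝟙 T ≫ (k.left ≫ pullback.fst A.X.hom f) = _
  exact Category.id_comp _

/-- A `T`-point of `Â` from an `M`-torsion section of `A_T` and `λ : A → Â`: `c_k := λ ∘ pr_A ∘ k`. [cite: MumfordAV1970, §20 (p. 184)] -/
def torsionPointHat (D : A.DualPair) (lam : A.X ⟶ D.hat.X) (k : (A.baseChange f).torsionSections M) :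
    Over.mk f ⟶ D.hat.X :=
  A.sectionToPointHom f (k : (A.baseChange f).Sections) ≫ lam

/-- `torsionPointHat_left` (plumbing for the W3 transport square). [cite: MumfordAV1970, §20 (p. 184)] -/
theorem torsionPointHat_left (D : A.DualPair) (lam : A.X ⟶ D.hat.X) (k : (A.baseChange f).torsionSections M) :
    (A.torsionPointHat M f D lam k).left = (k : (A.baseChange f).Sections).left ≫ pullback.fst A.X.hom f ≫ lam.left := by
  rw [torsionPointHat, Over.comp_left, sectionToPointHom_left, Category.assoc]

/-- `torsionPointHat_pow_eq_one` (plumbing for the W3 transport square). [cite: MumfordAV1970, §20 (p. 184)] -/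
theorem torsionPointHat_pow_eq_one (D : A.DualPair) (lam : A.X ⟶ D.hat.X) [IsMonHom lam]
    (k : (A.baseChange f).torsionSections M) :
    A.torsionPointHat M f D lam k ^ M = 1 := by
  rw [torsionPointHat, ← MonObj.pow_comp, ← map_pow, (A.baseChange f).torsionSections_pow M k, map_one, MonObj.one_comp]

end OverBase

/-! ## §2 The point datum at `t : Spec Ω ⟶ T` -/

section PointDatum

open scoped CategoryTheory.Obj

variable {T : Scheme.{u}} (f : T ⟶ S) {Ω : Type u} [Field Ω] (t : Spec (.of Ω) ⟶ T)

/-- The sections of `A_T` restricted to the point `t`, read as sections of `A_{t ≫ f} = A ×_S Spec Ω` (through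
`baseChangeCompGrpIso⁻¹ : (A_T)_t ≅ A_{t ≫ f}`), a group homomorphism. [cite: GortzWedhorn2020, Section (4.7), (4.7.1) (p. 108)] -/
def sectionAt : (A.baseChange f).Sections →* (A.baseChange (t ≫ f)).Sections where
  toFun k := (A.baseChange f).sectionBaseChange t k ≫ (A.baseChangeCompGrpIso f t).inv.hom.hom
  map_one' := by rw [map_one, MonObj.one_comp]
  map_mul' k k' := by rw [map_mul, MonObj.mul_comp]

/-- `sectionAt_apply` (plumbing for the W3 transport square). [cite: GortzWedhorn2020, Section (4.7), (4.7.1) (p. 108)] -/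
theorem sectionAt_apply (k : (A.baseChange f).Sections) :
    A.sectionAt f t k = (A.baseChange f).sectionBaseChange t k ≫ (A.baseChangeCompGrpIso f t).inv.hom.hom := rfl

/-- `sectionAt k ≫ ψ = k ×_T Spec Ω` for `ψ : A_{t ≫ f} ≅ (A_T)_t`. [cite: GortzWedhorn2020, Section (4.7), (4.7.1) (p. 108)] -/
theorem sectionAt_comp_hom (k : (A.baseChange f).Sections) :
    A.sectionAt f t k ≫ (A.baseChangeCompGrpIso f t).hom.hom.hom = (A.baseChange f).sectionBaseChange t k := by
  ext : 1
  rw [Over.comp_left, sectionAt_apply, Over.comp_left, Category.assoc, baseChangeCompGrpIso_inv_left_hom_left]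
  exact Category.comp_id _

/-- **The point of `A_{t ≫ f}` of a section of `A_T` restricted to `t` IS the ★ `fibrePointsMulEquiv`-image of its
★ `restrictPt`** (both have underlying morphism `(k ×_T Spec Ω) ≫ ψ⁻¹`). [cite: MumfordFogartyKirwan1994, Ch. 7 §2 Definition 7.1 (p. 129)] -/
theorem sectionPt_sectionAt' (k : (A.baseChange f).Sections) :
    A.sectionPt (t ≫ f) (A.sectionAt f t k) = A.fibrePointsMulEquiv f t ((A.baseChange f).restrictPt t k) := by
  ext : 1
  rw [sectionPt_left, sectionAt_apply, Over.comp_left, fibrePointsMulEquiv_apply, map_fibreBaseChangeIso_left,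
    fibreBaseChangeIso_hom_toSchemeHom, ← (A.baseChange f).sectionPt_sectionBaseChange t k, sectionPt_left]

variable [IsCommMonObj (A.baseChange f).X]

/-- **The `M`-torsion points `k(t) ∈ A_{t ≫ f}[M](Ω)` of the `M`-torsion sections of `A_T`**, as a group homomorphism
(underlying point `fibrePointsMulEquiv f t (restrictPt t k)`, `coe_baseChangeTorsionPt`). [cite: MumfordFogartyKirwan1994, Ch. 7 §2 Definition 7.1 (p. 129)] -/
def baseChangeTorsionPt :
    (A.baseChange f).torsionSections M →* (A.fibre (t ≫ f)).toAbelianVariety.torsionPoints Ω (M : ℤ) where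
  toFun k := ⟨A.fibrePointsMulEquiv f t ((A.baseChange f).restrictPt t (k : (A.baseChange f).Sections)), by
    refine (AbelianVariety.mem_torsionPoints_iff _ _).2 ?_
    rw [zpow_natCast, ← map_pow, (A.baseChange f).restrictPt_pow_eq_one t ((A.baseChange f).torsionSections_pow M k),
      map_one]⟩
  map_one' := Subtype.ext (by
    change A.fibrePointsMulEquiv f t ((A.baseChange f).restrictPt t (1 : (A.baseChange f).Sections)) = 1
    rw [restrictPt_one, map_one])
  map_mul' k k' := Subtype.ext (by
    change A.fibrePointsMulEquiv f t ((A.baseChange f).restrictPt t ((k : (A.baseChange f).Sections) * k')) = _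
    rw [restrictPt_mul, map_mul]
    rfl)

/-- The underlying point of `baseChangeTorsionPt k` (definitional). [cite: MumfordFogartyKirwan1994, Ch. 7 §2 Definition 7.1 (p. 129)] -/
@[simp]
theorem coe_baseChangeTorsionPt (k : (A.baseChange f).torsionSections M) :
    ((A.baseChangeTorsionPt M f t k : (A.fibre (t ≫ f)).toAbelianVariety.torsionPoints Ω (M : ℤ)) :
      (A.fibre (t ≫ f)).toAbelianVariety.Points Ω) =
      A.fibrePointsMulEquiv f t ((A.baseChange f).restrictPt t (k : (A.baseChange f).Sections)) := rfl

/-- `sectionPt_sectionAt_coe` (plumbing for the W3 transport square). [cite: MumfordFogartyKirwan1994, Ch. 7 §2 Definition 7.1 (p. 129)] -/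
theorem sectionPt_sectionAt_coe (k : (A.baseChange f).torsionSections M) :
    A.sectionPt (t ≫ f) (A.sectionAt f t (k : (A.baseChange f).Sections)) = (A.baseChangeTorsionPt M f t k).1 :=
  A.sectionPt_sectionAt' f t k

variable [IsCommMonObj (A.baseChange (t ≫ f)).X]

/-- **The translation action of `A_T[M](T)` on `A_{t ≫ f} = A ×_S Spec Ω` over `[M]`** (by the restricted sections): the
action `ρ′` at the geometric point `t` of `T`. [cite: MumfordAV1970, §20 (p. 184)] [cite: GortzWedhorn2023, Def. 27.1 (p. 604)] -/
def pointTranslationAction : ActionOver ((A.baseChange (t ≫ f)).mulN M).left ((A.baseChange f).torsionSections M) :=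
  (A.baseChange (t ≫ f)).translationActionOfHom M ((A.sectionAt f t).comp ((A.baseChange f).torsionSections M).subtype)
    fun k => by
      rw [MonoidHom.comp_apply, ← map_pow, Subgroup.subtype_apply, (A.baseChange f).torsionSections_pow M k, map_one]

/-- **`ρ′_k = t_{k(t)}`** — the hypothesis `hg` of ★ `weilPairingLevel_eq_inv_of_poincare_discrepancy` at `s := t ≫ f`. [cite: MumfordAV1970, §20 (p. 184)] [cite: GortzWedhorn2023, Def. 27.1 (p. 604)] -/
theorem pointTranslationAction_autHom_eq_translation (k : (A.baseChange f).torsionSections M) :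
    (A.pointTranslationAction M f t).autHom k =
      ((A.fibre (t ≫ f)).toAbelianVariety.translation (A.baseChangeTorsionPt M f t k).1).left := by
  rw [pointTranslationAction, autHom_translationActionOfHom_eq_translation_sectionPt, MonoidHom.comp_apply,
    Subgroup.subtype_apply, sectionPt_sectionAt_coe]

omit [IsCommMonObj (A.baseChange f).X] [IsCommMonObj (A.baseChange (t ≫ f)).X] in
/-- **`A_{t ≫ f} → A_T` over `t` is `ψ` followed by the projection `(A_T)_t → A_T`.** [cite: GortzWedhorn2020, Section (4.7), (4.7.1) (p. 108)] -/
theorem baseChangeRestrict_eq_comp :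
    A.baseChangeRestrict f t = (A.baseChangeCompGrpIso f t).hom.hom.hom.left ≫ pullback.fst (A.baseChange f).X.hom t := by
  refine pullback.hom_ext ?_ ?_
  · rw [baseChangeRestrict_comp_fst, Category.assoc]
    exact (A.baseChangeCompGrpIso_hom_left_fst_fst f t).symm
  · rw [baseChangeRestrict_comp_snd, Category.assoc]
    change _ = _ ≫ pullback.fst (A.baseChange f).X.hom t ≫ (A.baseChange f).X.hom
    rw [pullback.condition]
    change _ = _ ≫ pullback.snd (pullback.snd A.X.hom f) t ≫ t
    rw [A.baseChangeCompGrpIso_hom_left_snd_assoc f t]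

/-- **`ρ′` and `ρ` are intertwined by `A_{t ≫ f} → A_T`** — the hypothesis `hι` of ★ `pairingUnit_baseChange` /
`discrepancy_baseChange`. [cite: MumfordAV1970, §20 (p. 184)] [cite: GortzWedhorn2023, Def. 27.1 (p. 604)] -/
theorem pointTranslationAction_autHom_comp_baseChangeRestrict (k : (A.baseChange f).torsionSections M) :
    (A.pointTranslationAction M f t).autHom k ≫ A.baseChangeRestrict f t =
      A.baseChangeRestrict f t ≫ ((A.baseChange f).translationActionMulN M).autHom k := by
  rw [pointTranslationAction, translationActionOfHom_autHom, translationActionMulN_autHom, baseChangeRestrict_eq_comp,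
    ← Category.assoc, ← Over.comp_left, translation_comp_hom, MonoidHom.comp_apply, Subgroup.subtype_apply,
    sectionAt_comp_hom, Over.comp_left, Category.assoc, Category.assoc, (A.baseChange f).translation_sectionBaseChange t,
    baseChangeHom_left_comp_fst]

/-! ## §3 The line bundle at the point: `(1 × λ̄(k(t)))^*𝒫 = q^*((1 × c_k)^*𝒫)` -/

omit [IsCommMonObj (A.baseChange (t ≫ f)).X] in
/-- **`q ≫ (1_A × c_k) = 1_A × λ̄(k(t))`** as maps `A_{t ≫ f} → A ×_S Â`: the slice of `𝒫` at the point `λ̄(k(t))` of the fibre is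
the restriction along `q : A_{t ≫ f} → A_T` of the slice at the `T`-point `c_k = λ ∘ pr_A ∘ k`. [cite: MilneAV2008, I §8 pp. 36–37] [cite: MumfordFogartyKirwan1994, Ch. 6 §2 Definition 6.2 (p. 120)] -/
theorem baseChangeRestrict_comp_baseChangeToProd (D : A.DualPair) (lam : A.X ⟶ D.hat.X) (k : (A.baseChange f).torsionSections M) :
    A.baseChangeRestrict f t ≫ A.baseChangeToProd D.hat f (A.torsionPointHat M f D lam k).left (Over.w _) =
      A.baseChangeToProd D.hat (t ≫ f) (A.valueAt (t ≫ f) D lam (A.baseChangeTorsionPt M f t k).1)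
        (A.valueAt_comp_hom _ _ _ _) := by
  refine pullback.hom_ext ?_ ?_
  · rw [Category.assoc, baseChangeToProd_fst, baseChangeRestrict_comp_fst, baseChangeToProd_fst]
  · rw [Category.assoc, baseChangeToProd_snd, baseChangeRestrict_comp_snd_assoc, baseChangeToProd_snd, torsionPointHat_left,
      valueAt, coe_baseChangeTorsionPt, fibrePointsMulEquiv_apply]
    change _ = _ ≫ ((AlgPoints.map (A.fibreBaseChangeIso f t).hom.hom.hom.hom ((A.baseChange f).restrictPt t ↑k)).left ≫
      pullback.fst A.X.hom (t ≫ f)) ≫ lam.left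
    have hk : ((A.baseChange f).restrictPt t (k : (A.baseChange f).Sections)).left ≫ pullback.fst (pullback.snd A.X.hom f) t =
        t ≫ (k : (A.baseChange f).Sections).left :=
      (A.baseChange f).restrictPt_left_fst t (k : (A.baseChange f).Sections)
    rw [map_fibreBaseChangeIso_left]
    simp only [Category.assoc]
    rw [fibreBaseChangeIso_hom_toSchemeHom_fst_assoc]
    simp only [Category.assoc]
    rw [reassoc_of% hk]

/-- **`L_{k(t)} ≅ q^* L_{c_k}`**: the line bundle `(1 × λ̄(k(t)))^*𝒫 = 𝒫|_{A_{t ≫ f} × {λ̄(k(t))}}` of ★ (W3a) IS the restriction along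
`q : A_{t ≫ f} → A_T` of the line bundle `L_{c_k} = (1 × c_k)^*𝒫` of ★ (W1b) §3 — the `j₁` of ★ `discrepancy_baseChange`. [cite: MilneAV2008, I §8 pp. 36–37] [cite: MumfordFogartyKirwan1994, Ch. 6 §2 Definition 6.2 (p. 120)] -/
def pointLineBundleIso (D : A.DualPair) (lam : A.X ⟶ D.hat.X) (k : (A.baseChange f).torsionSections M) :
    D.pullbackP (t ≫ f) (A.valueAt (t ≫ f) D lam (A.baseChangeTorsionPt M f t k).1) (A.valueAt_comp_hom _ _ _ _) ≅
      (Scheme.Modules.pullback (A.baseChangeRestrict f t)).obj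
        (D.pullbackP f (A.torsionPointHat M f D lam k).left (Over.w _)) :=
  ((Scheme.Modules.pullbackCongr (baseChangeRestrict_comp_baseChangeToProd A M f t D lam k)).app D.P).symm ≪≫
    ((Scheme.Modules.pullbackComp (A.baseChangeRestrict f t)
      (A.baseChangeToProd D.hat f (A.torsionPointHat M f D lam k).left (Over.w _))).app D.P).symm

end PointDatum

end Literature.AlgebraicGeometry.AbelianSchemes.AbelianSchemeOver

end
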